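import Literature.NumberTheory.GaloisRepresentations.LubinTateColemanRelativeCoordTwo
import Literature.NumberTheory.GaloisRepresentations.LubinTateColemanRelativeLogDerivLimitTwo
import HarnessLib

/-!
# Theorem I.3.7 over an unramified base `k' = E` at `q = 2`: the IMAGE of `β ↦ r_β` — every `r ∈ 𝒪_E⟦Y⟧` whose constant
# term is of the form `c − u·φ(c)` is the coordinate of a norm-coherent unit along `E·K_π^∞`

De Shalit, *Iwasawa theory of elliptic curves with complex multiplication* (1987), Ch. I §3.7 Theorem (exactness of
`0 → 𝒰 → Λ → (𝒪_{k'}/p^N)(1) → 0`) with §3.12–3.14.  In the power-series currency of the tree (`f = πX + X²`, `F` with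
`|𝓀_F| = 2`, `π = 2u`, `u ∈ 𝒪_F^×`, `π ≡ m₁ (mod π²)` for some `m₁ ∈ ℕ` — all automatic for `F = ℚ₂`; `E ⊆ F^{nr}` finite Galois with
Frobenius `φ`; `β ∈ 𝒰(E·K_π^∞)` with relative Coleman series `g_β`, `δβ = δ_E g_β`, `(δβ)~ = (1 + u⁻¹X)·(r_β ∘ f)`,
`LubinTateColemanRelativeCoordTwo`):

* `exists_twistedTilde_eq_of_constantCoeff_eq` — the twisted Lemma 3.13 over `𝒪_E` WITH constant terms: `𝒮_E g = 0`,
  `g(0) = c − u·ψ(c)` ⟹ `g = h̃` for an `h` with `h(0) = c` and `𝒮_E h = π·h^ψ`;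
* `RelNormCoherentUnits.ofSeries` — **the norm-coherent unit of a twisted-invariant unit series** `G` (`𝒩_E G = G^φ`):
  `β_m = ((φ⁻¹)^{m+1}G)^ι(ω_{m+1})`, with `relColemanSeries_ofSeries : g_{ofSeries G} = G` (so `β ↦ g_β` is ONTO the units with
  `𝒩_E g = g^φ` — together with `eq_relColemanSeries` a bijection, de Shalit I §2.2 Theorem over `k'`);
* `constantCoeff_relUnitCoordTwo` — `r_β(0) = c − u·φ(c)` with `c = (δβ)(0)`;
* ★★★ `exists_relUnitCoordTwo_eq` / `exists_relUnitCoordTwo_eq_iff` — **`r ∈ 𝒪_E⟦Y⟧` is a coordinate `r_β` iff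
  `r(0) ∈ {c − u·φ(c) : c ∈ 𝒪_E}`**: the surjectivity half of Theorem I.3.7 over `k'` (cokernel `𝒪_E/(1 − uφ)𝒪_E`, de
  Shalit's `(𝒪_{k'}/p^N)(1)`), from `δ_E` onto (`LubinTateColemanRelativeLogDerivLimitTwo`) and the twisted Lemma 3.13;
* `relUnitCoordTwo_eq_iff`, `relLogDerivSeries_eq_of_relTildeSeries_eq` — toward the kernel: `r_β = r_{β'}` iff
  `(δβ)~ = (δβ')~`, and then `δβ = δβ'` as soon as `(δβ)(0) = (δβ')(0)`.

Everything PROVED (0 sorry).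

## References

* E. de Shalit, *Iwasawa theory of elliptic curves with complex multiplication* (1987), Ch. I §2.2 Theorem, §3.7 Theorem,
  §3.12–3.14. [deShalit1987]
-/

noncomputable section

open scoped PowerSeries.WithPiTopology

namespace Literature.NumberTheory.GaloisRepresentations

section RelativeExactTwo

open GaloisRepresentations.IsNonarchimedeanLocalField LubinTate ValuativeRel Field

variable {F : Type} [Field F] [ValuativeRel F] [TopologicalSpace F] [IsNonarchimedeanLocalField F]

attribute [local instance] ltNormUniformSpace ltNormIsUniformAddGroup rk1 nF nE fintypeResidueField

variable {π : 𝒪[F]} (hπ : (valuation F).IsUniformizer (π : F))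
variable (E : IntermediateField F (AlgebraicClosure F)) [FiniteDimensional F E]

/-! ### The twisted Lemma 3.13 with constant terms -/

set_option maxHeartbeats 800000 in
/-- ★ **Twisted Lemma 3.13 over `𝒪_E` with constant terms** (`π = 2u`, `ψ` a ring endomorphism of `𝒪_E` with `ψ(π) = π`): if
`𝒮_E g = 0` and `g(0) = c − u·ψ(c)`, then `g = h − u·(h^ψ ∘ f)` for an `h` with `h(0) = c`, and `𝒮_E h = π·h^ψ`
(`h = h₁ + c` with `h₁` the fixed point `h₁ = (g − (c − uψc)) + u·(h₁^ψ ∘ f)`). [cite: deShalit1987, Ch. I §3.13 Lemma] -/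
theorem exists_twistedTilde_eq_of_constantCoeff_eq (hq : residueFieldCard F = 2) {u : LTCoeff F}
    (hu : LTCoeff.of F π = residueFieldCard F * u) {ψ : unitBall E →+* unitBall E}
    (hψ : ψ (algebraMap 𝒪[F] (unitBall E) π) = algebraMap 𝒪[F] (unitBall E) π) {g : PowerSeries (unitBall E)}
    (hg : relTraceTwo hπ E hq g = 0) {c : unitBall E}
    (hgc : PowerSeries.constantCoeff g = c - algebraMap (LTCoeff F) (unitBall E) u * ψ c) :
    ∃ h : PowerSeries (unitBall E), PowerSeries.constantCoeff h = c ∧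
      h - PowerSeries.C (algebraMap (LTCoeff F) (unitBall E) u) *
          PowerSeries.subst ((ltSer F π).map (algebraMap (LTCoeff F) (unitBall E))) (PowerSeries.map ψ h) = g ∧
      relTraceTwo hπ E hq h = PowerSeries.C (algebraMap 𝒪[F] (unitBall E) π) * PowerSeries.map ψ h := by
  haveI := isAdicComplete_span_algebraMap_pi hπ E
  have hf := (isLTSeries_ltSer (F := F) π).map (algebraMap (LTCoeff F) (unitBall E))
  have hf1 : algebraMap 𝒪[F] (unitBall E) π ∣
      PowerSeries.coeff 1 ((ltSer F π).map (algebraMap (LTCoeff F) (unitBall E))) := by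
    rw [hf.coeff_one]; exact dvd_rfl
  have hs : PowerSeries.HasSubst ((ltSer F π).map (algebraMap (LTCoeff F) (unitBall E))) :=
    PowerSeries.HasSubst.of_constantCoeff_zero' hf.constantCoeff_eq_zero
  have hsC : ∀ x : unitBall E, PowerSeries.subst ((ltSer F π).map (algebraMap (LTCoeff F) (unitBall E))) (PowerSeries.C x) =
      PowerSeries.C x := fun x => by
    rw [← PowerSeries.coe_substAlgHom hs, PowerSeries.C_eq_algebraMap, AlgHom.commutes]
  have hpu : PowerSeries.C (algebraMap 𝒪[F] (unitBall E) π) =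
      PowerSeries.C 2 * PowerSeries.C (algebraMap (LTCoeff F) (unitBall E) u) := by
    rw [← map_mul]
    change PowerSeries.C (algebraMap (LTCoeff F) (unitBall E) (LTCoeff.of F π)) = _
    rw [hu, hq, map_mul, map_natCast, Nat.cast_ofNat]
  -- the fixed point for `g₀ = g − C(c − uψc)`
  obtain ⟨g₀, hg₀⟩ : ∃ g₀ : PowerSeries (unitBall E),
      g₀ = g - PowerSeries.C (c - algebraMap (LTCoeff F) (unitBall E) u * ψ c) := ⟨_, rfl⟩
  have hg₀0 : PowerSeries.constantCoeff g₀ = 0 := by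
    rw [hg₀, map_sub (PowerSeries.constantCoeff (R := unitBall E)), PowerSeries.constantCoeff_C, hgc, sub_self]
  obtain ⟨h₁, hh₁0, hh₁⟩ := exists_eq_add_C_mul_map_subst (p := algebraMap 𝒪[F] (unitBall E) π)
    hf.constantCoeff_eq_zero hf1 hψ (algebraMap (LTCoeff F) (unitBall E) u) hg₀0
  refine ⟨h₁ + PowerSeries.C c, ?_, ?_, ?_⟩
  · rw [map_add (PowerSeries.constantCoeff (R := unitBall E)), hh₁0, PowerSeries.constantCoeff_C, zero_add]
  · rw [map_add (PowerSeries.map ψ), PowerSeries.map_C, PowerSeries.subst_add hs, hsC]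
    have e : h₁ - PowerSeries.C (algebraMap (LTCoeff F) (unitBall E) u) *
        PowerSeries.subst ((ltSer F π).map (algebraMap (LTCoeff F) (unitBall E))) (PowerSeries.map ψ h₁) = g₀ := by
      rw [sub_eq_iff_eq_add]; exact hh₁
    rw [map_sub (PowerSeries.C (R := unitBall E)), map_mul (PowerSeries.C (R := unitBall E))] at hg₀
    linear_combination e + hg₀
  · -- `𝒮_E h = 𝒮_E g₀ + 2u·h₁^ψ + 2c = π·(h₁ + c)^ψ`
    have hS1 : relTraceTwo hπ E hq h₁ = relTraceTwo hπ E hq g₀ +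
        PowerSeries.C 2 * PowerSeries.C (algebraMap (LTCoeff F) (unitBall E) u) * PowerSeries.map ψ h₁ := by
      conv_lhs => rw [hh₁]
      rw [relTraceTwo_add hπ E hq, relTraceTwo_mul_subst, relTraceTwo_C hπ E hq]
    have hS0 : relTraceTwo hπ E hq g₀ = -(PowerSeries.C 2 * PowerSeries.C (c - algebraMap (LTCoeff F) (unitBall E) u * ψ c)) := by
      rw [hg₀, relTraceTwo_sub hπ E hq, hg, relTraceTwo_C hπ E hq, zero_sub]
    rw [relTraceTwo_add hπ E hq, hS1, hS0, relTraceTwo_C hπ E hq, map_add (PowerSeries.map ψ), PowerSeries.map_C, hpu,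
      map_sub (PowerSeries.C (R := unitBall E)), map_mul (PowerSeries.C (R := unitBall E))]
    ring

/-! ### Toward the kernel: `r_β = r_{β'} ⟺ (δβ)~ = (δβ')~`, and injectivity of `h ↦ h̃` at fixed constant term -/

variable [Normal F E] [IsGalois F E] (hq : residueFieldCard F = 2) (hE : E ≤ maxUnramified F)
  {σ₀ : absoluteGaloisGroup F} (hσ₀ : IsAbsArithFrob σ₀)

/-- `r_β = r_{β'}` iff `(δβ)~ = (δβ')~`. [cite: deShalit1987, Ch. I §3.7] -/
theorem relUnitCoordTwo_eq_iff (u : (LTCoeff F)ˣ) (hu : LTCoeff.of F π = residueFieldCard F * u)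
    (β β' : RelNormCoherentUnits hπ E) :
    relUnitCoordTwo hπ E hq hE hσ₀ u hu β = relUnitCoordTwo hπ E hq hE hσ₀ u hu β' ↔
      relTildeSeries hπ E hq hE hσ₀ (u : LTCoeff F) β = relTildeSeries hπ E hq hE hσ₀ (u : LTCoeff F) β' := by
  constructor
  · intro h
    rw [relTildeSeries_eq_relUnitCoordTwo hπ E hq hE hσ₀ u hu β, relTildeSeries_eq_relUnitCoordTwo hπ E hq hE hσ₀ u hu β', h]
  · intro h
    refine eq_relUnitCoordTwo hπ E hq hE hσ₀ u hu β' ?_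
    rw [← h, relTildeSeries_eq_relUnitCoordTwo hπ E hq hE hσ₀ u hu β]

/-- `(δβ)~ = (δβ')~` and `(δβ)(0) = (δβ')(0)` imply `δβ = δβ'` (twisted `h ↦ h̃` is injective at fixed constant term).
[cite: deShalit1987, Ch. I §3.14] -/
theorem relLogDerivSeries_eq_of_relTildeSeries_eq (u : LTCoeff F) {β β' : RelNormCoherentUnits hπ E}
    (h : relTildeSeries hπ E hq hE hσ₀ u β = relTildeSeries hπ E hq hE hσ₀ u β')
    (h0 : PowerSeries.constantCoeff (relLogDerivSeries hπ E hq hE hσ₀ β) =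
      PowerSeries.constantCoeff (relLogDerivSeries hπ E hq hE hσ₀ β')) :
    relLogDerivSeries hπ E hq hE hσ₀ β = relLogDerivSeries hπ E hq hE hσ₀ β' :=
  twistedTilde_injective_of_constantCoeff_eq hπ E u (frobUnitBall_algebraMap_pi E σ₀) h h0

/-- **`r_β(0) = (δβ)(0) − u·φ((δβ)(0))`**: the constant terms of coordinates lie in the image of the relative anomaly map
`c ↦ c − u·φ(c)` of `𝒪_E`. [cite: deShalit1987, Ch. I §3.7] -/
theorem constantCoeff_relUnitCoordTwo (u : (LTCoeff F)ˣ) (hu : LTCoeff.of F π = residueFieldCard F * u)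
    (β : RelNormCoherentUnits hπ E) :
    PowerSeries.constantCoeff (relUnitCoordTwo hπ E hq hE hσ₀ u hu β) =
      PowerSeries.constantCoeff (relLogDerivSeries hπ E hq hE hσ₀ β) -
        algebraMap (LTCoeff F) (unitBall E) u *
          (frobUnitBall E σ₀ : unitBall E →+* unitBall E) (PowerSeries.constantCoeff (relLogDerivSeries hπ E hq hE hσ₀ β)) := by
  have h1 := congrArg PowerSeries.constantCoeff (relTildeSeries_eq_relUnitCoordTwo hπ E hq hE hσ₀ u hu β)
  rw [constantCoeff_relTildeSeries, map_mul (PowerSeries.constantCoeff (R := unitBall E)),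
    map_add (PowerSeries.constantCoeff (R := unitBall E)), map_one, map_mul (PowerSeries.constantCoeff (R := unitBall E)),
    PowerSeries.constantCoeff_C, PowerSeries.constantCoeff_X, mul_zero, add_zero, one_mul, constantCoeff_subst_map_ltSer] at h1
  exact h1.symm

/-! ### The norm-coherent unit of a twisted-invariant unit series -/

omit [IsGalois F E] in
/-- `(φ⁻¹)^k G` is twisted-invariant when `G` is. [cite: deShalit1987, Ch. I §2.3 (ii)] -/
theorem relNormTwo_map_symm_iterate {G : PowerSeries (unitBall E)}
    (hG : relNormTwo hπ E hq G = PowerSeries.map (frobUnitBall E σ₀ : unitBall E →+* unitBall E) G) (k : ℕ) :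
    relNormTwo hπ E hq ((PowerSeries.map ((frobUnitBall E σ₀).symm : unitBall E →+* unitBall E))^[k] G) =
      PowerSeries.map (frobUnitBall E σ₀ : unitBall E →+* unitBall E)
        ((PowerSeries.map ((frobUnitBall E σ₀).symm : unitBall E →+* unitBall E))^[k] G) := by
  have hφsπ : ((frobUnitBall E σ₀).symm : unitBall E →+* unitBall E) (algebraMap 𝒪[F] (unitBall E) π) =
      algebraMap 𝒪[F] (unitBall E) π := symm_algebraMap_pi E (frobUnitBall_algebraMap_pi E σ₀)
  induction k with
  | zero => exact hG
  | succ k ih =>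
    rw [Function.iterate_succ_apply', ← map_relNormTwo hπ E hq hφsπ, ih, map_symm_map]
    have h1 := map_symm_map E (frobUnitBall E σ₀).symm
      ((PowerSeries.map ((frobUnitBall E σ₀).symm : unitBall E →+* unitBall E))^[k] G)
    rw [RingEquiv.symm_symm] at h1
    exact h1.symm

omit [IsGalois F E] in
/-- `φ^a ((φ⁻¹)^{a+b} G) = (φ⁻¹)^b G`. [cite: deShalit1987, Ch. I §2.2] -/
theorem map_iterate_map_symm_iterate (G : PowerSeries (unitBall E)) (a b : ℕ) :
    (PowerSeries.map (frobUnitBall E σ₀ : unitBall E →+* unitBall E))^[a]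
        ((PowerSeries.map ((frobUnitBall E σ₀).symm : unitBall E →+* unitBall E))^[a + b] G) =
      (PowerSeries.map ((frobUnitBall E σ₀).symm : unitBall E →+* unitBall E))^[b] G := by
  induction a generalizing G with
  | zero => rw [zero_add, Function.iterate_zero_apply]
  | succ a ih =>
    rw [show a + 1 + b = (a + b) + 1 by ring, Function.iterate_succ_apply, Function.iterate_succ_apply']
    have h1 := map_symm_map E (frobUnitBall E σ₀).symm
      ((PowerSeries.map ((frobUnitBall E σ₀).symm : unitBall E →+* unitBall E))^[a + b] G)
    rw [RingEquiv.symm_symm] at h1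
    rw [h1, ih]

omit [Normal F E] [IsGalois F E] in
/-- **`‖G^ι(y)‖ = 1` for `G` with unit constant term** (`G^ι(y) ≡ G(0)` modulo `𝔪_{E'}`, ultrametric).
[cite: deShalit1987, Ch. I §2.2 Theorem] -/
theorem norm_evS_map_eq_one_of_isUnit_constantCoeff {E' : IntermediateField F (AlgebraicClosure F)} [FiniteDimensional F E']
    (h : E ≤ E') {G : PowerSeries (unitBall E)} (hG : IsUnit (PowerSeries.constantCoeff G)) (y : (maxNilIdeal F E').toIdeal) :
    ‖((evS (maxNilIdeal F E') y (PowerSeries.map (inclUnitBall (F := F) h : unitBall E →+* unitBall E') G) :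
      unitBall E') : E')‖ = 1 := by
  have hy : ‖((y : unitBall E') : E')‖ < 1 := y.2
  have h1 : ‖((evS (maxNilIdeal F E') y (PowerSeries.map (inclUnitBall (F := F) h : unitBall E →+* unitBall E')
      (G - PowerSeries.C (PowerSeries.constantCoeff G))) : unitBall E') : E')‖ ≤ ‖((y : unitBall E') : E')‖ := by
    change ‖((PowerSeries.aeval (isTopologicallyNilpotent_of_norm_lt_one E' hy)
      (PowerSeries.map (inclUnitBall (F := F) h : unitBall E →+* unitBall E')
        (G - PowerSeries.C (PowerSeries.constantCoeff G))) : unitBall E') : E')‖ ≤ _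
    refine norm_aeval_le_of_coeff_le (K := 1) _ hy (norm_nonneg _) (fun k hk => ?_) (by rw [pow_one])
    have hk0 : k = 0 := by omega
    subst hk0
    rw [PowerSeries.coeff_map, map_sub, PowerSeries.coeff_zero_eq_constantCoeff, PowerSeries.constantCoeff_C, sub_self,
      map_zero, ZeroMemClass.coe_zero, norm_zero]
    exact norm_nonneg _
  rw [map_sub, PowerSeries.map_C, map_sub, evS_C, AddSubgroupClass.coe_sub] at h1
  -- `‖ι G(0)‖ = 1`
  have hB : ‖((inclUnitBall (F := F) h (PowerSeries.constantCoeff G) : unitBall E') : E')‖ = 1 := by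
    rw [norm_inclUnitBall]
    have hu := (Valuation.Integers.isUnit_iff_valuation_eq_one (Valuation.integer.integers (NormedField.valuation (K := E)))).mp hG
    exact congrArg Subtype.val hu
  have hlt := lt_of_le_of_lt h1 hy
  -- ultrametric: `A = B + (A − B)` with `‖A − B‖ < 1 = ‖B‖`
  have hne : ‖((inclUnitBall (F := F) h (PowerSeries.constantCoeff G) : unitBall E') : E')‖ ≠
      ‖((evS (maxNilIdeal F E') y (PowerSeries.map (inclUnitBall (F := F) h : unitBall E →+* unitBall E') G) : unitBall E') : E') -
        ((inclUnitBall (F := F) h (PowerSeries.constantCoeff G) : unitBall E') : E')‖ := by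
    rw [hB]; exact (ne_of_lt hlt).symm
  have e : ((evS (maxNilIdeal F E') y (PowerSeries.map (inclUnitBall (F := F) h : unitBall E →+* unitBall E') G) : unitBall E') : E') =
      ((inclUnitBall (F := F) h (PowerSeries.constantCoeff G) : unitBall E') : E') +
        (((evS (maxNilIdeal F E') y (PowerSeries.map (inclUnitBall (F := F) h : unitBall E →+* unitBall E') G) : unitBall E') : E') -
          ((inclUnitBall (F := F) h (PowerSeries.constantCoeff G) : unitBall E') : E')) := by ring
  rw [e, IsUltrametricDist.norm_add_eq_max_of_norm_ne_norm hne, hB]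
  exact max_eq_left hlt.le

include hE in
set_option maxHeartbeats 800000 in
/-- **The norm-coherent unit `β = ofSeries G` of a twisted-invariant unit series** `G ∈ 𝒪_E⟦X⟧ˣ`, `𝒩_E G = G^φ`:
`β_m = ((φ⁻¹)^{m+1} G)^ι(ω_{m+1})` (norm-coherence from de Shalit's (2) over `𝒪_E` and Cor. 2.3 (ii)).
[cite: deShalit1987, Ch. I §2.2 Theorem, §2.3 (ii)] -/
def RelNormCoherentUnits.ofSeries (G : PowerSeries (unitBall E))
    (hG : relNormTwo hπ E hq G = PowerSeries.map (frobUnitBall E σ₀ : unitBall E →+* unitBall E) G)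
    (hG0 : IsUnit (PowerSeries.constantCoeff G)) : RelNormCoherentUnits hπ E where
  val m := evS (maxNilIdeal F (E ⊔ ltField π m : IntermediateField F (AlgebraicClosure F)))
    (inclPt (le_sup_right : ltField π m ≤ E ⊔ ltField π m) (cohPt hπ m))
    (PowerSeries.map (inclUnitBall (F := F) (le_sup_left : E ≤ E ⊔ ltField π m) :
      unitBall E →+* unitBall (E ⊔ ltField π m : IntermediateField F (AlgebraicClosure F)))
      ((PowerSeries.map ((frobUnitBall E σ₀).symm : unitBall E →+* unitBall E))^[m + 1] G))
  norm_eq_one m := by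
    refine norm_evS_map_eq_one_of_isUnit_constantCoeff E le_sup_left ?_ _
    rw [← map_pow_eq_iterate, ← PowerSeries.coeff_zero_eq_constantCoeff_apply, PowerSeries.coeff_map,
      PowerSeries.coeff_zero_eq_constantCoeff_apply]
    exact hG0.map _
  coherent n m hnm := by
    letI := towerAlgebra (sup_le_sup_left (ltField_mono hπ hnm) E)
    apply IntermediateField.inclusion_injective (sup_le_sup_left (ltField_mono hπ hnm) E)
    rw [algebraMap_towerNorm_sup_eq_prod_relStab hπ E m hnm,
      prod_relStab_algEquiv_evS_of_relNormTwo_eq_map hπ E m hE hq hnm (frobUnitBall_algebraMap_pi E σ₀)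
        (relNormTwo_map_symm_iterate hπ E hq hG (m + 1)),
      show m + 1 = (m - n) + (n + 1) by omega, map_iterate_map_symm_iterate]
    rfl

set_option maxHeartbeats 800000 in
/-- ★ **`g_{ofSeries G} = G`**: the relative Coleman series of `ofSeries G` is `G` itself (uniqueness of interpolation) — so
`β ↦ g_β` is a bijection between `𝒰(E·K_π^∞)` and the units `G` of `𝒪_E⟦X⟧` with `𝒩_E G = G^φ`.
[cite: deShalit1987, Ch. I §2.2 Theorem] -/
theorem relColemanSeries_ofSeries (G : PowerSeries (unitBall E))
    (hG : relNormTwo hπ E hq G = PowerSeries.map (frobUnitBall E σ₀ : unitBall E →+* unitBall E) G)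
    (hG0 : IsUnit (PowerSeries.constantCoeff G)) :
    relColemanSeries hπ E hq hE hσ₀ (RelNormCoherentUnits.ofSeries hπ E hq hE G hG hG0 : RelNormCoherentUnits hπ E) = G :=
  (eq_relColemanSeries hπ E hq hE hσ₀ (β := RelNormCoherentUnits.ofSeries hπ E hq hE G hG hG0) (g := G) fun _ => rfl).symm

/-! ### The image of `β ↦ r_β` -/

set_option maxHeartbeats 800000 in
/-- ★★★ **Theorem I.3.7 over `k' = E`, surjectivity half** (`q = 2`, `π = 2u`, `u ∈ 𝒪_F^×`, `π ≡ m₁ (mod π²)` for some `m₁ ∈ ℕ`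
— automatic for `F = ℚ₂`; `E ⊆ F^{nr}` finite Galois with Frobenius `φ`): **every `r ∈ 𝒪_E⟦Y⟧` with `r(0) = c − u·φ(c)` for
some `c ∈ 𝒪_E` is the coordinate `r_β` of a norm-coherent unit `β` along `E·K_π^∞`** — `g = (1 + u⁻¹X)(r ∘ f)` is
trace-zero, `g = h̃` with `𝒮_E h = π h^φ` (twisted Lemma 3.13), `h = δ_E G` with `𝒩_E G = G^φ` (`δ_E` onto), `β = ofSeries G`.
The cokernel of `β ↦ r_β ↦ r_β(0)` is `𝒪_E/(1 − u·φ)𝒪_E`, de Shalit's `(𝒪_{k'}/p^N)(1)`. [cite: deShalit1987, Ch. I §3.7 Theorem] -/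
theorem exists_relUnitCoordTwo_eq (u : (LTCoeff F)ˣ) (hu : LTCoeff.of F π = residueFieldCard F * u)
    (hm : ∃ m₁ : ℕ, LTCoeff.of F π ^ 2 ∣ LTCoeff.of F π - m₁) (r : PowerSeries (unitBall E)) (c : unitBall E)
    (hr : PowerSeries.constantCoeff r =
      c - algebraMap (LTCoeff F) (unitBall E) u * (frobUnitBall E σ₀ : unitBall E →+* unitBall E) c) :
    ∃ β : RelNormCoherentUnits hπ E, relUnitCoordTwo hπ E hq hE hσ₀ u hu β = r := by
  obtain ⟨m₁, hm₁⟩ := hm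
  have ht := two_eq_of_mul_inv hq u hu
  -- the trace-zero series `g = (1 + u⁻¹X)(r ∘ f)` with `g(0) = r(0)`
  obtain ⟨g, hgdef⟩ : ∃ g : PowerSeries (unitBall E),
      g = (1 + PowerSeries.C (algebraMap (LTCoeff F) (unitBall E) (↑u⁻¹ : LTCoeff F)) * PowerSeries.X) *
        PowerSeries.subst ((ltSer F π).map (algebraMap (LTCoeff F) (unitBall E))) r := ⟨_, rfl⟩
  have hSg : relTraceTwo hπ E hq g = 0 := (relTraceTwo_eq_zero_iff hπ E hq ht g).mpr ⟨r, hgdef⟩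
  have hg0 : PowerSeries.constantCoeff g =
      c - algebraMap (LTCoeff F) (unitBall E) u * (frobUnitBall E σ₀ : unitBall E →+* unitBall E) c := by
    rw [hgdef, map_mul (PowerSeries.constantCoeff (R := unitBall E)), map_add (PowerSeries.constantCoeff (R := unitBall E)),
      map_one, map_mul (PowerSeries.constantCoeff (R := unitBall E)), PowerSeries.constantCoeff_C, PowerSeries.constantCoeff_X,
      mul_zero, add_zero, one_mul, constantCoeff_subst_map_ltSer, hr]
  -- `g = h̃`, `𝒮_E h = π h^φ`
  obtain ⟨h, -, hht, hhS⟩ := exists_twistedTilde_eq_of_constantCoeff_eq hπ E hq hu (frobUnitBall_algebraMap_pi E σ₀) hSg hg0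
  -- `h = δ_E G` with `𝒩_E G = G^φ`
  obtain ⟨G, hGN, -, hGδ⟩ := exists_relNormTwo_eq_map_relLogDeriv_eq hπ E hq u hu hm₁ (frobUnitBall E σ₀)
    (frobUnitBall_algebraMap_LTCoeff E σ₀) (frobUnitBall_sub_sq_mem hπ E hq hE hσ₀) hhS
  have hG0 : IsUnit (PowerSeries.constantCoeff (G : PowerSeries (unitBall E))) := PowerSeries.isUnit_constantCoeff _ G.isUnit
  refine ⟨RelNormCoherentUnits.ofSeries hπ E hq hE _ hGN hG0, ?_⟩
  have hgβ := relColemanSeries_ofSeries hπ E hq hE hσ₀ (G : PowerSeries (unitBall E)) hGN hG0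
  have hδβ : relLogDerivSeries hπ E hq hE hσ₀ (RelNormCoherentUnits.ofSeries hπ E hq hE _ hGN hG0) = h := by
    rw [relLogDerivSeries, ← hGδ]
    congr 1
    exact Units.ext (by rw [IsUnit.unit_spec, hgβ])
  symm
  refine eq_relUnitCoordTwo hπ E hq hE hσ₀ u hu _ ?_
  rw [relTildeSeries, hδβ, hht, hgdef]

/-- ★★★ **Theorem I.3.7 over `k'`, the image exactly**: `r` is a coordinate `r_β` **iff** `r(0) = c − u·φ(c)` for some `c ∈ 𝒪_E`.
[cite: deShalit1987, Ch. I §3.7 Theorem] -/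
theorem exists_relUnitCoordTwo_eq_iff (u : (LTCoeff F)ˣ) (hu : LTCoeff.of F π = residueFieldCard F * u)
    (hm : ∃ m₁ : ℕ, LTCoeff.of F π ^ 2 ∣ LTCoeff.of F π - m₁) (r : PowerSeries (unitBall E)) :
    (∃ β : RelNormCoherentUnits hπ E, relUnitCoordTwo hπ E hq hE hσ₀ u hu β = r) ↔
      ∃ c : unitBall E, PowerSeries.constantCoeff r =
        c - algebraMap (LTCoeff F) (unitBall E) u * (frobUnitBall E σ₀ : unitBall E →+* unitBall E) c := by
  constructor
  · rintro ⟨β, rfl⟩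
    exact ⟨_, constantCoeff_relUnitCoordTwo hπ E hq hE hσ₀ u hu β⟩
  · rintro ⟨c, hc⟩
    exact exists_relUnitCoordTwo_eq hπ E hq hE hσ₀ u hu hm r c hc

end RelativeExactTwo

end Literature.NumberTheory.GaloisRepresentations
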